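import Summits.BirchSwinnertonDyer.BirchSwinnertonDyer.Theorems.BiquadraticEisensteinDescentManinDatumSupercuspidalCMInertFiveDivisionEisensteinJZero
import Summits.BirchSwinnertonDyer.BirchSwinnertonDyer.Theorems.BiquadraticEisensteinDescentManinDatumSupercuspidalCMInertFormalChord
import HarnessLib

set_option linter.dupNamespace false -- `Summit.BirchSwinnertonDyer.BirchSwinnertonDyer.Theorems.…` (summit = sub, D-0017)
set_option autoImplicit false

/-!
# Crux `ManinDatumSupercuspidalCMInert` (stmt-BirchSwinnertonDyer-20111, BED r605), stub `stub_S5` (`j = 0` at `p = 5`): prime-to-`5`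
# torsion of `y² = x³ − 1` has `5`-integral coordinates, and the `5`-division points `t_d = (d₁ρ + d₂)/5` of `ℤρ + ℤ`

Route `BiquadraticEisensteinDescent` (cell `pub/bsd-wall`, width seat `bsd-wall-cm-bed-w1` g8; `--supports` stmt-BirchSwinnertonDyer-20111,
helper). THEOREMS ONLY (no definition, no named fact, no `sorry`); nothing is closed by this file and BSD is not proved by any of it.

Second CM-side brick of `stub_S5` (sequel to `…FiveDivisionEisensteinJZero`, p641325): the `ℤρ + ℤ` / `y² = x³ − 1` twins of
`…InertBadAtThreeQuarticTorsionCoordinates.torsion_coord_isIntegral`, `…FormalChord.val_normalized_le_one_of_torsion` and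
`…TorsionSumRational.{divPoint_not_mem, natCast_mul_divPoint_not_mem, weierstrassP_ne_of_torsion}` — the integrality and separation
inputs of the X-formal expansion / resolvent packaging (`…TorsionCoreOfResolventBound`) at the `j = 0` cell, in the normalised coordinates
`X = ℘(w)/ϖ₁²`, `Y = ℘′(w)/(2ϖ₁³)` (`ϖ₁ = 2^{2/3}Γ(1/3)³/(4π)`, `…FiveDivisionEisensteinJZero.four_mul_varpi_pow_six`):

* `val_natCast_eq_one_of_coprime` — any valued field, any natural `p` with `v p < 1`: `v ℓ = 1` for `ℓ` coprime to `p` (Bézout);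
* `torsion_coord_isIntegral_rho` — `w ∉ Λ = ℤρ + ℤ`, `n w ∈ Λ`, `n ≠ 0` ⇒ `n²X(w)` and `n³Y(w)` are algebraic integers (`X(w)` is a root of
  `ΨSqₙ ∈ ℤ[X]` of `⟨0,0,0,0,−1⟩`, leading coefficient `n²`; `(n³Y)² = (n²X)³ − n⁶`);
* `val_normalized_le_one_of_torsion_rho` — `w ∉ Λ`, `M′w ∈ Λ`, `(M′, 5) = 1` ⇒ `v X(w) ≤ 1`, `v Y(w) ≤ 1` at every valuation `v` of `ℂ` with
  `v 5 < 1`;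
* `natCast_mul_notMem_of_coprime` — any lattice: `w ∉ Λ`, `n w ∈ Λ`, `(m, n) = 1` ⇒ `m w ∉ Λ`;
* the `5`-division points `t_d = (d₁ρ + d₂)/5`, `d ∈ (ℤ/5)²` (coordinates `d₁.val, d₂.val`): `five_mul_divPointRho_mem`, `divPointRho_notMem` (`d ≠ 0`),
  `divPointRho_neg_add_mem` (`t_{−d} + t_d ∈ Λ` — the pairing `d ↔ −d` of `PeriodPair.sum_mul_eisensteinE₁_sub_eq`),
  `natCast_mul_divPointRho_notMem` (`M′t_d ∉ Λ` for `(M′,5) = 1`), ★ `weierstrassP_ne_divPointRho_of_torsion` (`℘(w) ≠ ℘(t_d)` for prime-to-`5`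
  torsion `w ∉ Λ` and `d ≠ 0`).

References: [SilvermanAEC2009] Ex. 3.7 (division polynomials), VII.3.4; [Rubin1999] §7.4.
-/

noncomputable section

open Polynomial Complex

namespace Summit.BirchSwinnertonDyer.BirchSwinnertonDyer.Theorems.BiquadraticEisensteinDescentManinDatumSupercuspidalCMInertTorsionCoordinatesJZero

open Summit.BirchSwinnertonDyer.BirchSwinnertonDyer.Theorems.BiquadraticEisensteinDescentManinDatumSupercuspidalCMInertSevenDivisionEisenstein
  (val_intCast_le_one)
open Summit.BirchSwinnertonDyer.BirchSwinnertonDyer.Theorems.BiquadraticEisensteinDescentManinDatumSupercuspidalCMInertFormalChord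
  (val_le_one_of_isIntegral)
open Summit.BirchSwinnertonDyer.BirchSwinnertonDyer.Theorems.BiquadraticEisensteinDescentManinDatumSupercuspidalCMInertFiveDivisionEisensteinJZero
  (varpiRho_pos four_mul_varpi_pow_six ΨSq_five_equianharmonic preΨ'_five_equianharmonic)

/-! ## §1 Valuation currency -/

section Valued

variable {F Γ₀ : Type*} [Field F] [LinearOrderedCommGroupWithZero Γ₀] (v : Valuation F Γ₀)

/-- **`v ℓ = 1` for `ℓ` coprime to `p` once `v p < 1`** (Bézout: `1 = aℓ + bp`). [folklore] -/
theorem val_natCast_eq_one_of_coprime {p : ℕ} (hp : v (p : F) < 1) {ℓ : ℕ} (hℓ : Nat.Coprime ℓ p) : v (ℓ : F) = 1 := by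
  refine le_antisymm (by exact_mod_cast val_intCast_le_one v ℓ) ?_
  by_contra hlt
  push Not at hlt
  obtain ⟨a, b, hab⟩ := (Nat.isCoprime_iff_coprime.mpr hℓ)
  have h1 : (1 : F) = (a : F) * ℓ + (b : F) * p := by
    have h := congrArg (Int.cast (R := F)) hab
    push_cast at h
    exact h.symm
  have : v (1 : F) < 1 := by
    rw [h1]
    refine Valuation.map_add_lt v ?_ ?_
    · rw [Valuation.map_mul]
      calc v (a : F) * v (ℓ : F) ≤ 1 * v (ℓ : F) := mul_le_mul' (val_intCast_le_one v a) le_rfl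
        _ = v (ℓ : F) := one_mul _
        _ < 1 := hlt
    · rw [Valuation.map_mul]
      calc v (b : F) * v (p : F) ≤ 1 * v (p : F) := mul_le_mul' (val_intCast_le_one v b) le_rfl
        _ = v (p : F) := one_mul _
        _ < 1 := hp
  rw [Valuation.map_one] at this
  exact lt_irrefl _ this

end Valued

/-! ## §2 Torsion coordinates on `y² = x³ − 1` are integral up to the order -/

section Analytic

open scoped PeriodPair
open PeriodPair Literature.NumberTheory.EllipticCurves

/-- **Torsion coordinates are integral up to the order** (`j = 0` model). If `w ∉ Λ = ℤρ + ℤ`, `n·w ∈ Λ`, `n ≠ 0`, then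
`n²·℘(w)/ϖ₁²` and `n³·℘′(w)/(2ϖ₁³)` are algebraic integers: `x = ℘(w)/ϖ₁²` is a root of the division polynomial `ΨSqₙ ∈ ℤ[X]` of
`⟨0,0,0,0,−1⟩` (the curve of the lattice `ϖ₁Λ`), whose leading coefficient is `n²`, and `(n³y)² = (n²x)³ − n⁶` for `y = ℘′(w)/(2ϖ₁³)`.
[cite: SilvermanAEC2009, Exercise 3.7 (d)] -/
theorem torsion_coord_isIntegral_rho {w : ℂ} {n : ℕ} (hw : w ∉ (ofUpperHalfPlane UpperHalfPlane.ρ).lattice)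
    (hn : ((n : ℂ) * w) ∈ (ofUpperHalfPlane UpperHalfPlane.ρ).lattice) (hn0 : n ≠ 0) :
    IsIntegral ℤ ((n : ℂ) ^ 2 *
      (℘[ofUpperHalfPlane UpperHalfPlane.ρ] w / (((2 : ℝ) ^ (2 / 3 : ℝ) * Real.Gamma (1 / 3) ^ 3 / (4 * Real.pi) : ℝ) : ℂ) ^ 2)) ∧
    IsIntegral ℤ ((n : ℂ) ^ 3 *
      (℘'[ofUpperHalfPlane UpperHalfPlane.ρ] w / (2 * (((2 : ℝ) ^ (2 / 3 : ℝ) * Real.Gamma (1 / 3) ^ 3 / (4 * Real.pi) : ℝ) : ℂ) ^ 3))) := by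
  set ϖ : ℂ := (((2 : ℝ) ^ (2 / 3 : ℝ) * Real.Gamma (1 / 3) ^ 3 / (4 * Real.pi) : ℝ) : ℂ) with hϖ
  have hϖ0 : ϖ ≠ 0 := Complex.ofReal_ne_zero.mpr varpiRho_pos.ne'
  have hg3Λ : (ofUpperHalfPlane UpperHalfPlane.ρ).g₃ = 4 * ϖ ^ 6 := by rw [hϖ, four_mul_varpi_pow_six]
  set L' : PeriodPair := (ofUpperHalfPlane UpperHalfPlane.ρ).mulLeft ϖ hϖ0 with hL'
  have hg2 : L'.g₂ = 0 := by
    rw [hL', PeriodPair.g₂_mulLeft, PeriodPair.g₂_ofUpperHalfPlane_ρ, mul_zero]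
  have hg3 : L'.g₃ = 4 := by
    rw [hL', PeriodPair.g₃_mulLeft, hg3Λ]
    field_simp
  have hW : (⟨0, 0, 0, 0, -1⟩ : WeierstrassCurve ℤ).map (algebraMap ℤ ℂ) = L'.curve :=
    PeriodPair.map_eq_curve (by rw [hg2]; norm_num) (by rw [hg3]; norm_num)
  have hw' : ϖ * w ∉ L'.lattice := by
    rw [hL', PeriodPair.mul_mem_mulLeft_lattice]; exact hw
  have hnw' : ((n : ℤ) : ℂ) * (ϖ * w) ∈ L'.lattice := by
    rw [show ((n : ℤ) : ℂ) * (ϖ * w) = ϖ * ((n : ℂ) * w) by push_cast; ring, hL',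
      PeriodPair.mul_mem_mulLeft_lattice]
    exact hn
  have hroot := PeriodPair.aeval_weierstrassP_ΨSq_eq_zero hW hw' hnw'
  have hPw : ℘[L'] (ϖ * w) = ℘[ofUpperHalfPlane UpperHalfPlane.ρ] w / ϖ ^ 2 := by
    rw [hL', PeriodPair.weierstrassP_mulLeft, div_eq_inv_mul]
  rw [hPw] at hroot
  have hlc := (⟨0, 0, 0, 0, -1⟩ : WeierstrassCurve ℤ).leadingCoeff_ΨSq (n := (n : ℤ)) (by simp [hn0])
  have hX : IsIntegral ℤ ((n : ℂ) ^ 2 * (℘[ofUpperHalfPlane UpperHalfPlane.ρ] w / ϖ ^ 2)) := by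
    have h := isIntegral_leadingCoeff_smul _ _ hroot
    rw [hlc, zsmul_eq_mul] at h
    simpa using h
  refine ⟨hX, ?_⟩
  -- `(n³y)² = (n²x)³ − n⁶`
  have hQ2 := (ofUpperHalfPlane UpperHalfPlane.ρ).derivWeierstrassP_sq w hw
  rw [PeriodPair.g₂_ofUpperHalfPlane_ρ, hg3Λ, zero_mul, sub_zero] at hQ2
  have hY2 : ((n : ℂ) ^ 3 * (℘'[ofUpperHalfPlane UpperHalfPlane.ρ] w / (2 * ϖ ^ 3))) ^ 2 =
      ((n : ℂ) ^ 2 * (℘[ofUpperHalfPlane UpperHalfPlane.ρ] w / ϖ ^ 2)) ^ 3 - (n : ℂ) ^ 6 := by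
    field_simp
    linear_combination hQ2
  refine IsIntegral.of_pow two_pos ?_
  rw [hY2]
  have h6 : IsIntegral ℤ ((n : ℂ) ^ 6) :=
    (by simpa using isIntegral_algebraMap (R := ℤ) (A := ℂ) (x := (n : ℤ)) : IsIntegral ℤ (n : ℂ)).pow 6
  exact (hX.pow 3).sub h6

/-- **Prime-to-`5` torsion of `y² = x³ − 1` is `5`-integral.** For `w ∉ Λ = ℤρ + ℤ` with `M′w ∈ Λ`, `(M′, 5) = 1`, and every valuation
`v` of `ℂ` with `v 5 < 1`: `v X(w) ≤ 1` and `v Y(w) ≤ 1` (`M′²X`, `M′³Y` are algebraic integers and `v M′ = 1`).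
[cite: SilvermanAEC2009, VII.3.4] -/
theorem val_normalized_le_one_of_torsion_rho {Γ₀ : Type*} [LinearOrderedCommGroupWithZero Γ₀] (v : Valuation ℂ Γ₀) (h5 : v 5 < 1)
    {w : ℂ} {M' : ℕ} (hw : w ∉ (ofUpperHalfPlane UpperHalfPlane.ρ).lattice)
    (hMw : ((M' : ℂ) * w) ∈ (ofUpperHalfPlane UpperHalfPlane.ρ).lattice) (hM5 : Nat.Coprime M' 5) :
    v (℘[ofUpperHalfPlane UpperHalfPlane.ρ] w / (((2 : ℝ) ^ (2 / 3 : ℝ) * Real.Gamma (1 / 3) ^ 3 / (4 * Real.pi) : ℝ) : ℂ) ^ 2) ≤ 1 ∧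
    v (℘'[ofUpperHalfPlane UpperHalfPlane.ρ] w / (2 * (((2 : ℝ) ^ (2 / 3 : ℝ) * Real.Gamma (1 / 3) ^ 3 / (4 * Real.pi) : ℝ) : ℂ) ^ 3)) ≤ 1 := by
  have hM0 : M' ≠ 0 := by
    rintro rfl
    rw [Nat.cast_zero, zero_mul] at hMw
    exact absurd hM5 (by decide)
  obtain ⟨hX, hY⟩ := torsion_coord_isIntegral_rho hw hMw hM0
  have hvM : v ((M' : ℂ)) = 1 := val_natCast_eq_one_of_coprime v (p := 5) (by exact_mod_cast h5) hM5
  have h1 := val_le_one_of_isIntegral v hX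
  have h2 := val_le_one_of_isIntegral v hY
  rw [Valuation.map_mul, Valuation.map_pow, hvM, one_pow, one_mul] at h1 h2
  exact ⟨h1, h2⟩

/-! ## §3 The `5`-division points `t_d = (d₁ρ + d₂)/5` of `ℤρ + ℤ` -/

/-- **Bézout on torsion orders** (any lattice): `w ∉ Λ`, `n w ∈ Λ`, `(m, n) = 1` ⇒ `m w ∉ Λ`. [folklore] -/
theorem natCast_mul_notMem_of_coprime (L : PeriodPair) {w : ℂ} {m n : ℕ} (hw : w ∉ L.lattice) (hn : ((n : ℂ) * w) ∈ L.lattice)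
    (hmn : Nat.Coprime m n) : (m : ℂ) * w ∉ L.lattice := by
  intro hm
  obtain ⟨a, b, hab⟩ := (Nat.isCoprime_iff_coprime.mpr hmn)
  apply hw
  have h1 : w = (a : ℂ) * ((m : ℂ) * w) + (b : ℂ) * ((n : ℂ) * w) := by
    have h := congrArg (Int.cast (R := ℂ)) hab
    push_cast at h
    linear_combination (-w) * h
  rw [h1]
  exact add_mem (by simpa [zsmul_eq_mul] using L.lattice.smul_mem a hm) (by simpa [zsmul_eq_mul] using L.lattice.smul_mem b hn)

/-- `5·t_d ∈ Λ` for `t_d = (d₁ρ + d₂)/5`. [folklore] -/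
theorem five_mul_divPointRho_mem (d : ZMod 5 × ZMod 5) :
    (5 : ℂ) * (((d.1.val : ℂ) * UpperHalfPlane.ρ + (d.2.val : ℂ)) / 5) ∈ (ofUpperHalfPlane UpperHalfPlane.ρ).lattice := by
  rw [EisensteinLattice.mem_lattice_iff]
  exact ⟨d.1.val, d.2.val, by push_cast; field_simp⟩

/-- `t_d ∉ Λ` for `d ≠ 0` (compare coordinates in the basis `ρ, 1`: `5 ∣ dᵢ.val < 5`). [folklore] -/
theorem divPointRho_notMem {d : ZMod 5 × ZMod 5} (hd : d ≠ 0) :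
    ((d.1.val : ℂ) * UpperHalfPlane.ρ + (d.2.val : ℂ)) / 5 ∉ (ofUpperHalfPlane UpperHalfPlane.ρ).lattice := by
  intro h
  rw [EisensteinLattice.mem_lattice_iff] at h
  obtain ⟨m, n, hmn⟩ := h
  have hρ : ((UpperHalfPlane.ρ : UpperHalfPlane) : ℂ) = ⟨-1 / 2, Real.sqrt 3 / 2⟩ := rfl
  have him := congrArg Complex.im hmn
  have hre := congrArg Complex.re hmn
  simp only [hρ, Complex.add_im, Complex.mul_im, Complex.intCast_re, Complex.intCast_im, Complex.div_ofNat_im,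
    Complex.natCast_im, Complex.natCast_re, zero_mul, add_zero, Complex.add_re, Complex.mul_re,
    Complex.div_ofNat_re, sub_zero] at him hre
  have hs : Real.sqrt 3 ≠ 0 := by positivity
  -- imaginary parts: `m = d₁/5`; real parts: `−m/2 + n = (−d₁/2 + d₂)/5`
  have h1 : (5 : ℝ) * m = d.1.val := by
    have : (m : ℝ) * (Real.sqrt 3 / 2) * 5 = (d.1.val : ℝ) * (Real.sqrt 3 / 2) := by linarith
    have h' : ((5 : ℝ) * m - d.1.val) * Real.sqrt 3 = 0 := by linarith
    rcases mul_eq_zero.mp h' with h0 | h0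
    · linarith
    · exact absurd h0 hs
  have h2 : (5 : ℝ) * n = d.2.val + 5 * m / 2 - (d.1.val : ℝ) / 2 := by linarith
  have h1z : (5 : ℤ) * m = (d.1.val : ℤ) := by exact_mod_cast h1
  have h2z : (5 : ℤ) * (2 * n - m) = 2 * (d.2.val : ℤ) - d.1.val := by
    have : (5 : ℝ) * (2 * n - m) = 2 * (d.2.val : ℝ) - d.1.val := by linarith
    exact_mod_cast this
  have hd1 : (5 : ℤ) ∣ (d.1.val : ℤ) := ⟨m, h1z.symm⟩
  have hd2 : (5 : ℤ) ∣ (d.2.val : ℤ) := by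
    have h3 : (5 : ℤ) ∣ 2 * (d.2.val : ℤ) := by
      have : 2 * (d.2.val : ℤ) = 5 * (2 * n - m) + d.1.val := by linarith
      rw [this]; exact dvd_add (dvd_mul_right _ _) hd1
    exact (Int.isCoprime_iff_gcd_eq_one.mpr rfl : IsCoprime (5 : ℤ) 2).dvd_of_dvd_mul_left h3
  have e1 : d.1 = 0 := by
    rw [← ZMod.natCast_zmod_val d.1, ZMod.natCast_eq_zero_iff]; exact_mod_cast hd1
  have e2 : d.2 = 0 := by
    rw [← ZMod.natCast_zmod_val d.2, ZMod.natCast_eq_zero_iff]; exact_mod_cast hd2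
  exact hd (Prod.ext e1 e2)

/-- **The pairing `d ↔ −d`**: `t_{−d} + t_d ∈ Λ` (the representatives of `−dᵢ` and `dᵢ` add up to `0` or `5`).
[folklore] -/
theorem divPointRho_neg_add_mem (d : ZMod 5 × ZMod 5) :
    (((-d).1.val : ℂ) * UpperHalfPlane.ρ + ((-d).2.val : ℂ)) / 5 + ((d.1.val : ℂ) * UpperHalfPlane.ρ + (d.2.val : ℂ)) / 5 ∈
      (ofUpperHalfPlane UpperHalfPlane.ρ).lattice := by
  -- `(−x).val + x.val = 5·e` with `e ∈ {0, 1}`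
  have key : ∀ x : ZMod 5, ∃ e : ℤ, (((-x).val : ℤ) + x.val) = 5 * e := by
    intro x; fin_cases x <;> first | exact ⟨0, by decide⟩ | exact ⟨1, by decide⟩
  obtain ⟨e1, he1⟩ := key d.1
  obtain ⟨e2, he2⟩ := key d.2
  rw [EisensteinLattice.mem_lattice_iff]
  refine ⟨e1, e2, ?_⟩
  rw [Prod.fst_neg, Prod.snd_neg]
  have h1 : (((-d.1).val : ℂ)) + (d.1.val : ℂ) = 5 * (e1 : ℂ) := by exact_mod_cast he1
  have h2 : (((-d.2).val : ℂ)) + (d.2.val : ℂ) = 5 * (e2 : ℂ) := by exact_mod_cast he2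
  rw [← add_div, eq_div_iff (by norm_num : (5 : ℂ) ≠ 0)]
  linear_combination (-((UpperHalfPlane.ρ : UpperHalfPlane) : ℂ)) * h1 - h2

/-- `M′·t_d ∉ Λ` for `d ≠ 0` and `(M′, 5) = 1`. [folklore] -/
theorem natCast_mul_divPointRho_notMem {M' : ℕ} (hM : Nat.Coprime M' 5) {d : ZMod 5 × ZMod 5} (hd : d ≠ 0) :
    (M' : ℂ) * (((d.1.val : ℂ) * UpperHalfPlane.ρ + (d.2.val : ℂ)) / 5) ∉ (ofUpperHalfPlane UpperHalfPlane.ρ).lattice :=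
  natCast_mul_notMem_of_coprime _ (divPointRho_notMem hd) (five_mul_divPointRho_mem d) hM

/-- ★ **Separation**: for prime-to-`5` torsion `w ∉ Λ` (`M′w ∈ Λ`, `(M′,5) = 1`) and `d ≠ 0`, `℘(w) ≠ ℘(t_d)` (`w ± t_d ∉ Λ`, since
`M′(w ± t_d) ∈ Λ` would force `M′t_d ∈ Λ`). [folklore] -/
theorem weierstrassP_ne_divPointRho_of_torsion {M' : ℕ} (hM : Nat.Coprime M' 5) {w : ℂ}
    (hw : w ∉ (ofUpperHalfPlane UpperHalfPlane.ρ).lattice) (hMw : (M' : ℂ) * w ∈ (ofUpperHalfPlane UpperHalfPlane.ρ).lattice)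
    {d : ZMod 5 × ZMod 5} (hd : d ≠ 0) :
    ℘[ofUpperHalfPlane UpperHalfPlane.ρ] w ≠ ℘[ofUpperHalfPlane UpperHalfPlane.ρ] (((d.1.val : ℂ) * UpperHalfPlane.ρ + (d.2.val : ℂ)) / 5) := by
  set Λ := (ofUpperHalfPlane UpperHalfPlane.ρ).lattice with hΛ
  set u : ℂ := ((d.1.val : ℂ) * UpperHalfPlane.ρ + (d.2.val : ℂ)) / 5 with hu
  have huΛ : u ∉ Λ := divPointRho_notMem hd
  have hMu : (M' : ℂ) * u ∉ Λ := natCast_mul_divPointRho_notMem hM hd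
  have h1 : w + u ∉ Λ := by
    intro h
    apply hMu
    have := Λ.sub_mem (Λ.smul_mem (M' : ℤ) h) hMw
    simpa [zsmul_eq_mul, mul_add] using this
  have h2 : w - u ∉ Λ := by
    intro h
    apply hMu
    have := Λ.sub_mem hMw (Λ.smul_mem (M' : ℤ) h)
    simpa [zsmul_eq_mul, mul_sub] using this
  intro h
  rcases ((ofUpperHalfPlane UpperHalfPlane.ρ).weierstrassP_eq_weierstrassP_iff hw huΛ).mp h with h' | h'
  · exact h1 h'
  · exact h2 h'

end Analytic

end Summit.BirchSwinnertonDyer.BirchSwinnertonDyer.Theorems.BiquadraticEisensteinDescentManinDatumSupercuspidalCMInertTorsionCoordinatesJZero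

end
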